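import Literature.NumberTheory.Rogawski1990.ArchCentralLimitFormula                    -- ★ p842205: the letter `ArchCentralLimitFormulaRankTwo` (registered in `stub_L21`)
import Literature.NumberTheory.Rogawski1990.ArchCentralLimitFunctionalSymmetryEightRay    -- ★ p842285 (F0P3a-p06): COLLAPSE `tendsto_lambda8_rhoWeylDelta_mul_comp_perm`
import Literature.NumberTheory.Automorphic.ArchLocalRelabelTransport                   -- ★ (F0P3a-p07 (g7)): `e_σ : G_w(α∘σ) ≃ₜ* G_w(α)`, Haar ∕ test-function ∕ orbital-integral transport
import Literature.NumberTheory.Automorphic.ArchLocalRegularOrbitClosed                 -- ★ `locallyCompactSpace_archLocal`, `secondCountableTopology_archLocal`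
import HarnessLib

/-!
# ROAD A, brick (G-perm): `ArchCentralLimitFormulaRankTwo` IS INVARIANT UNDER RELABELLING THE FRAME — the letter at `(L, α ∘ σ, w)` implies the letter at `(L, α, w)`
# (Rogawski 1990 §8.4 p. 126: the statement is about the group `U(2,1)`, not about the order in which the diagonal form is written)

Topic `NumberTheory/Rogawski1990`; namespace `Literature.NumberTheory.Rogawski1990`.  THEOREMS ONLY (no `def`, no instance, no notation, no axiom, no named fact, no `sorry`).
Cell `pub/hodgecm-mathlib`, ENGINE T1 (crux H413 = `stmt-HodgeConjecture-24833`); ROAD A toward N1 = the registered stub `stub_L21 : ∀ L α w, ArchCentralLimitFormulaRankTwo L α w`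
(closer ED. 25∕26) ∕ `stub_ArchCentralLimitU21` («SdArch» ED. 3); ROAD A owner F0P3a-p05 (g14) WORD R-14.3 (d) «ASSEMBLY-READINESS» (F0P3a-p02 (g13), census 2026-09-01T12:0xZ, FILE A).

WHY.  ★ (G) `archCentralLimitFormulaRankTwo_of_signs` ∕ `…_of_cm_signs` (A-p18, p843608) reduce the `∀ (L, α, w)` letter to the SIX indefinite `±1`-frames `s : Fin 3 → ℚ(ζ₅)`, keeping the
INDEX POSITIONS of the signs.  ROAD A computes at frames whose COMPACT pair is `{0,1}` (★ `ArchCentralLimitCompactWall*`: wall `θ₀ = θ₁`; ★ (h4)∕(J3-odd): noncompact wall `θ₀ = θ₂`),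
i.e. at the two frames `(1,1,−1)`, `(−1,−1,1)`; the other four (`{0,2}`- and `{1,2}`-compact) are RELABELLINGS `s = s′ ∘ σ`.  This file supplies the relabelling transport
**`archCentralLimitFormulaRankTwo_of_perm (σ) : ArchCentralLimitFormulaRankTwo L (α ∘ σ) w → ArchCentralLimitFormulaRankTwo L α w`** and its iff form.
PROOF.  ★ `ArchLocalRelabelTransport`: `e_σ : G_w(α∘σ) ≃ₜ* G_w(α)`, `g ↦ M(σ)gM(σ)⁻¹`, carries `diag z ↦ diag(z∘σ⁻¹)`, a Haar right-invariant `ν` on `G_w(α)` to the Haar right-invariant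
`(e_σ⁻¹)_*ν` on `G_w(α∘σ)`, the test function `Θ` to `Θ_σ = Θ ∘ Ad M(σ)` (smooth, compact support on the group kept), and the torus orbital integrals by
`Φ^{α}_Θ(z ∘ σ⁻¹) = Φ^{α∘σ}_{Θ_σ}(z)` (★ `integral_comp_conj_circleDiagonal_comp_perm_eq_integral_ambient`).  The letter at `(α∘σ, (e_σ⁻¹)_*ν, Θ_σ, ζ)` is the `Tendsto` of
`Λ₈[ρ′Δ·Ψ]`, `Ψ = Φ^{α∘σ}_{Θ_σ}`; the COLLAPSE lemma ★ `tendsto_lambda8_rhoWeylDelta_mul_comp_perm` (`ρ′Δ` and the 8-ray functional alternate together) turns it into the `Tendsto` of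
`Λ₈[ρ′Δ·(Ψ∘(·∘σ))] = Λ₈[ρ′Δ·Φ^α_Θ]` with the same constant, and `Θ_σ(ζ•1) = Θ(ζ•1)` (`M(σ)` commutes with scalars).  The guards transport trivially (`(α∘σ)_i ≠ 0`, reality, one
indefinite pair).
HONEST LABEL: HC_CM is proved only modulo the printed citations until rung 0 closes; this file proves an implication between instances of one letter, nothing about the letter itself.

## References
* [Rogawski1990] J. D. Rogawski, *Automorphic Representations of Unitary Groups in Three Variables*, Ann. of Math. Stud. 123 (1990), §8.4 pp. 126–127, §8.2 p. 122.
* [BrockerTomDieck1985] Th. Bröcker, T. tom Dieck, *Representations of Compact Lie Groups*, GTM 98 (1985), IV (3.2) (permutation matrices act on the diagonal torus).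
-/

set_option autoImplicit false

noncomputable section

open MeasureTheory Measure Filter Topology NumberField NumberField.InfinitePlace Matrix Equiv
open Literature.NumberTheory.Automorphic Literature.NumberTheory.Automorphic.UnitaryGroup Literature.LinearAlgebra.Matrix
open scoped MatrixGroups Matrix.Norms.Operator

namespace Literature.NumberTheory.Rogawski1990

section OfPerm

variable (L : Type) [Field L] (α : Fin 3 → L) (w : {w : InfinitePlace L // IsComplex w})

/-- The indefiniteness guard is relabelling-invariant. [cite: Rogawski1990, §8.4 p. 126] -/
theorem exists_mul_re_neg_comp_perm (σ : Perm (Fin 3))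
    (hind : ∃ i j : Fin 3, (w.1.embedding (α i)).re * (w.1.embedding (α j)).re < 0) :
    ∃ i j : Fin 3, (w.1.embedding ((α ∘ ⇑σ) i)).re * (w.1.embedding ((α ∘ ⇑σ) j)).re < 0 := by
  obtain ⟨i, j, h⟩ := hind
  exact ⟨σ.symm i, σ.symm j, by simpa only [Function.comp_apply, Equiv.apply_symm_apply] using h⟩

/-- The permutation matrix `M(σ)` commutes with the scalar torus point: `M(σ) · diag(ζ,ζ,ζ) · M(σ)⁻¹ = diag(ζ,ζ,ζ)`. [cite: BrockerTomDieck1985, IV (3.2)] -/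
theorem monomial_conj_circleDiagonal_const (σ : Perm (Fin 3)) (ζ : Circle) :
    (monomial σ fun _ : Fin 3 => (1 : ℂ)) * ((circleDiagonal 3 (fun _ : Fin 3 => ζ) : GL (Fin 3) ℂ) : Matrix (Fin 3) (Fin 3) ℂ) *
        (((Matrix.GeneralLinearGroup.mkOfDetNeZero _ (det_monomial_one_ne_zero 3 σ))⁻¹ : GL (Fin 3) ℂ) : Matrix (Fin 3) (Fin 3) ℂ) =
      ((circleDiagonal 3 (fun _ : Fin 3 => ζ) : GL (Fin 3) ℂ) : Matrix (Fin 3) (Fin 3) ℂ) := by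
  have h := congrArg (fun u : GL (Fin 3) ℂ => (u : Matrix (Fin 3) (Fin 3) ℂ)) (monomial_conj_circleDiagonal 3 σ (fun _ : Fin 3 => ζ))
  simpa only [Units.val_mul, Matrix.GeneralLinearGroup.val_mkOfDetNeZero] using h

/-- **(G-perm) THE LETTER IS RELABELLING-INVARIANT**: `ArchCentralLimitFormulaRankTwo L (α ∘ σ) w → ArchCentralLimitFormulaRankTwo L α w` for every `σ ∈ S₃`
(relabelling iso `e_σ`, Haar pulled back, `Θ ↦ Θ ∘ Ad M(σ)`, orbital integrals `Φ^α_Θ(z∘σ⁻¹) = Φ^{α∘σ}_{Θ_σ}(z)`, COLLAPSE for the 8-ray functional).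
[cite: Rogawski1990, §8.4 pp. 126–127] [cite: BrockerTomDieck1985, IV (3.2)] -/
theorem archCentralLimitFormulaRankTwo_of_perm (σ : Perm (Fin 3)) (h : ArchCentralLimitFormulaRankTwo L (α ∘ ⇑σ) w) :
    ArchCentralLimitFormulaRankTwo L α w := by
  intro _ _ _ _ hα hreal hind ν _ _
  -- topology and Borel structure on the relabelled frame `G_w(α ∘ σ)`
  haveI : LocallyCompactSpace (archLocal L 3 (Matrix.diagonal (α ∘ ⇑σ)) w) := locallyCompactSpace_archLocal L 3 (Matrix.diagonal (α ∘ ⇑σ)) w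
  haveI : SecondCountableTopology (archLocal L 3 (Matrix.diagonal (α ∘ ⇑σ)) w) := secondCountableTopology_archLocal L 3 (Matrix.diagonal (α ∘ ⇑σ)) w
  letI : MeasurableSpace (archLocal L 3 (Matrix.diagonal (α ∘ ⇑σ)) w) := borel _
  haveI : BorelSpace (archLocal L 3 (Matrix.diagonal (α ∘ ⇑σ)) w) := ⟨rfl⟩
  -- the pulled-back Haar measure `(e_σ⁻¹)_* ν`
  haveI hH := (ContinuousMulEquiv.restrictSubgroup (GLn.conjEquiv (Matrix.GeneralLinearGroup.mkOfDetNeZero _ (det_monomial_one_ne_zero 3 σ)))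
        (archLocal L 3 (Matrix.diagonal (α ∘ ⇑σ)) w) (archLocal L 3 (Matrix.diagonal α) w) (mem_archLocal_comp_perm_iff_conj_mem L 3 α w σ)).symm.isHaarMeasure_map ν
  haveI hR := isMulRightInvariant_map_relabel_symm L 3 α w σ ν
  -- the letter at the relabelled frame
  have hα' : ∀ i, (α ∘ ⇑σ) i ≠ 0 := fun i => hα (σ i)
  have hreal' : ∀ i, (w.1.embedding ((α ∘ ⇑σ) i)).im = 0 := fun i => hreal (σ i)
  obtain ⟨c, hc, hmain⟩ := h hα' hreal' (exists_mul_re_neg_comp_perm L α w σ hind)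
    (ν.map (ContinuousMulEquiv.restrictSubgroup (GLn.conjEquiv (Matrix.GeneralLinearGroup.mkOfDetNeZero _ (det_monomial_one_ne_zero 3 σ)))
        (archLocal L 3 (Matrix.diagonal (α ∘ ⇑σ)) w) (archLocal L 3 (Matrix.diagonal α) w) (mem_archLocal_comp_perm_iff_conj_mem L 3 α w σ)).symm)
  refine ⟨c, hc, fun Θ hΘ hsupp ζ => ?_⟩
  -- the transported test function `Θ_σ = Θ ∘ Ad M(σ)` and the letter at `(α∘σ, (e_σ⁻¹)_*ν, Θ_σ, ζ)`
  have key := hmain (fun A : Matrix (Fin 3) (Fin 3) ℂ => Θ ((monomial σ fun _ : Fin 3 => (1 : ℂ)) * A *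
      (((Matrix.GeneralLinearGroup.mkOfDetNeZero _ (det_monomial_one_ne_zero 3 σ))⁻¹ : GL (Fin 3) ℂ) : Matrix (Fin 3) (Fin 3) ℂ)))
    (contDiff_comp_monomial_conj 3 σ Θ hΘ) (hasCompactSupport_comp_relabel L 3 α w σ Θ hsupp) ζ
  -- name the relabelled orbital integral `Ψ`
  obtain ⟨Ψ, hΨ⟩ : ∃ Ψ : (Fin 3 → Circle) → ℂ, Ψ = fun r : Fin 3 → Circle =>
      ∫ g' : archLocal L 3 (Matrix.diagonal (α ∘ ⇑σ)) w,
        Θ ((monomial σ fun _ : Fin 3 => (1 : ℂ)) *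
            ((((g' * ⟨circleDiagonal 3 r, circleDiagonal_mem_archLocal_diagonal L 3 (α ∘ ⇑σ) w r⟩ * g'⁻¹ :
              archLocal L 3 (Matrix.diagonal (α ∘ ⇑σ)) w) : GL (Fin 3) ℂ) : Matrix (Fin 3) (Fin 3) ℂ)) *
          (((Matrix.GeneralLinearGroup.mkOfDetNeZero _ (det_monomial_one_ne_zero 3 σ))⁻¹ : GL (Fin 3) ℂ) : Matrix (Fin 3) (Fin 3) ℂ))
        ∂(ν.map (ContinuousMulEquiv.restrictSubgroup (GLn.conjEquiv (Matrix.GeneralLinearGroup.mkOfDetNeZero _ (det_monomial_one_ne_zero 3 σ)))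
        (archLocal L 3 (Matrix.diagonal (α ∘ ⇑σ)) w) (archLocal L 3 (Matrix.diagonal α) w) (mem_archLocal_comp_perm_iff_conj_mem L 3 α w σ)).symm) := ⟨_, rfl⟩
  -- COLLAPSE: the letter for `Ψ` gives the letter for `Ψ ∘ (· ∘ σ)`
  have hcol := tendsto_lambda8_rhoWeylDelta_mul_comp_perm Ψ σ (ζ := ζ)
    (ℓ := -((c : ℂ) * Complex.I) * Θ ((monomial σ fun _ : Fin 3 => (1 : ℂ)) * ((circleDiagonal 3 (fun _ : Fin 3 => ζ) : GL (Fin 3) ℂ) : Matrix (Fin 3) (Fin 3) ℂ) *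
      (((Matrix.GeneralLinearGroup.mkOfDetNeZero _ (det_monomial_one_ne_zero 3 σ))⁻¹ : GL (Fin 3) ℂ) : Matrix (Fin 3) (Fin 3) ℂ)))
    (by simpa only [hΨ] using key)
  -- `Ψ(r ∘ σ) = Φ^α_Θ(r)`: the relabelled orbital integral read back on `G_w(α)`
  have hback : ∀ r : Fin 3 → Circle,
      (∫ g' : archLocal L 3 (Matrix.diagonal (α ∘ ⇑σ)) w,
        Θ ((monomial σ fun _ : Fin 3 => (1 : ℂ)) *
            ((((g' * ⟨circleDiagonal 3 (r ∘ ⇑σ), circleDiagonal_mem_archLocal_diagonal L 3 (α ∘ ⇑σ) w (r ∘ ⇑σ)⟩ * g'⁻¹ :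
              archLocal L 3 (Matrix.diagonal (α ∘ ⇑σ)) w) : GL (Fin 3) ℂ) : Matrix (Fin 3) (Fin 3) ℂ)) *
          (((Matrix.GeneralLinearGroup.mkOfDetNeZero _ (det_monomial_one_ne_zero 3 σ))⁻¹ : GL (Fin 3) ℂ) : Matrix (Fin 3) (Fin 3) ℂ))
        ∂(ν.map (ContinuousMulEquiv.restrictSubgroup (GLn.conjEquiv (Matrix.GeneralLinearGroup.mkOfDetNeZero _ (det_monomial_one_ne_zero 3 σ)))
        (archLocal L 3 (Matrix.diagonal (α ∘ ⇑σ)) w) (archLocal L 3 (Matrix.diagonal α) w) (mem_archLocal_comp_perm_iff_conj_mem L 3 α w σ)).symm)) =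
      ∫ g : archLocal L 3 (Matrix.diagonal α) w,
        Θ ((((g * ⟨circleDiagonal 3 r, circleDiagonal_mem_archLocal_diagonal L 3 α w r⟩ * g⁻¹ : archLocal L 3 (Matrix.diagonal α) w) : GL (Fin 3) ℂ) :
          Matrix (Fin 3) (Fin 3) ℂ)) ∂ν := by
    intro r
    rw [← integral_comp_conj_circleDiagonal_comp_perm_eq_integral_ambient L 3 α w σ ν Θ (r ∘ ⇑σ)]
    have hr : (⟨circleDiagonal 3 (fun i => (r ∘ ⇑σ) (σ.symm i)), circleDiagonal_mem_archLocal_diagonal L 3 α w (fun i => (r ∘ ⇑σ) (σ.symm i))⟩ :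
        archLocal L 3 (Matrix.diagonal α) w) = ⟨circleDiagonal 3 r, circleDiagonal_mem_archLocal_diagonal L 3 α w r⟩ := by
      apply Subtype.ext
      simp only [Function.comp_apply, Equiv.apply_symm_apply]
    rw [hr]
  have hcen : Θ ((monomial σ fun _ : Fin 3 => (1 : ℂ)) * ((circleDiagonal 3 (fun _ : Fin 3 => ζ) : GL (Fin 3) ℂ) : Matrix (Fin 3) (Fin 3) ℂ) *
      (((Matrix.GeneralLinearGroup.mkOfDetNeZero _ (det_monomial_one_ne_zero 3 σ))⁻¹ : GL (Fin 3) ℂ) : Matrix (Fin 3) (Fin 3) ℂ)) =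
      Θ ((circleDiagonal 3 (fun _ : Fin 3 => ζ) : GL (Fin 3) ℂ) : Matrix (Fin 3) (Fin 3) ℂ) := by
    rw [monomial_conj_circleDiagonal_const]
  simp only [hΨ, hback, hcen] at hcol
  exact hcol

/-- Iff form: the letters at `(L, α, w)` and `(L, α ∘ σ, w)` are equivalent (`α = (α ∘ σ) ∘ σ⁻¹`). [cite: Rogawski1990, §8.4 pp. 126–127] -/
theorem archCentralLimitFormulaRankTwo_comp_perm_iff (σ : Perm (Fin 3)) :
    ArchCentralLimitFormulaRankTwo L (α ∘ ⇑σ) w ↔ ArchCentralLimitFormulaRankTwo L α w := by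
  refine ⟨archCentralLimitFormulaRankTwo_of_perm L α w σ, fun h => ?_⟩
  have e : (α ∘ ⇑σ) ∘ ⇑σ.symm = α := by
    funext i
    simp only [Function.comp_apply, Equiv.apply_symm_apply]
  have hcast : ArchCentralLimitFormulaRankTwo L ((α ∘ ⇑σ) ∘ ⇑σ.symm) w = ArchCentralLimitFormulaRankTwo L α w := by rw [e]
  intro _ _ _ _ hα hreal hind ν _ _
  exact archCentralLimitFormulaRankTwo_of_perm L (α ∘ ⇑σ) w σ.symm (hcast.mpr h) hα hreal hind ν

end OfPerm

end Literature.NumberTheory.Rogawski1990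

end
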